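import Mathlib
import Literature.RingTheory.CohomologyAnnihilator.Basic
import Literature.RingTheory.CohomologyAnnihilator.SyzygyBasic
import Literature.RingTheory.CohomologyAnnihilator.TowerBasic
import Literature.RingTheory.CohomologyAnnihilator.TowerSyzygy
import Literature.RingTheory.CohomologyAnnihilator.StrongGenerator
import Summits.ResolutionOfSingularities.ResolutionOfSingularities.Theorems.HomologicalConductorPersistenceSurfaceSaturationReflexiveSyzygy
import HarnessLib

/-!
# Rung S-2 `PersistenceSurface` (stmt-ResolutionOfSingularities-19970), stub C1 `SaturationFourSurfaceResidual₄`: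
# `Sat₄` from ONE finitely generated module `G` with `Ω Ref ⊆ add G` and `G ∈ add Ω(add G)` — the
# finite-type form of the special-class door

Route `ResolutionOfSingularities/HomologicalConductor`, chain W4.4b, rung S-2 `PersistenceSurface`
(stmt-ResolutionOfSingularities-19970), registered skeleton 1a77c002, stub
`stub_saturationFourSurfaceResidualFour : SaturationFourSurfaceResidual₄`.  [OURS · pure module theory over LANDED
tree lemmas; AI-written, weaker than expert review; NOT a statement of the manuscript under study (Hironaka 2017) and
no statement of that manuscript is used.]  DEF-FREE: no new `def`, no conjecture, no named fact.

The special-class door `PersistenceSurfaceSaturationReflexiveSyzygy.cohomologyAnnihilator_eq_four_of_reflexiveSyzygyClass`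
(p828941) takes an arbitrary class `𝒮`.  At a stage where the candidate class is `add G` for ONE finitely generated
module `G` — e.g. the direct sum of the finitely many indecomposable special Cohen–Macaulay modules of a rational
surface singularity (Wunram / Iyama–Wemyss; motivation only), or the sum of the «cospecial pieces» of the tree's
cyclic-quotient theorems — the two hypotheses become FINITE checks on `G`:

* `(hΩ)`  every first syzygy module of every finitely generated reflexive module lies in `add G`
  (`IsRetractOfPower G`, [IyengarTakahashi2014, Def. 4.1]);
* `(hrec)` `G` is a retract of a first syzygy module of some member of `add G` («`G ∈ add Ω(add G)`», e.g.
  `G ∣ Ω(Gᵐ) ⊕ free`).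

This file proves the closure `isRetractOfPower_recurrent` (with the tree's `IsSyzygy.pi`, finite powers of first
syzygy chains) («`add G` is a recurrent class under `(hrec)`»), and the doors
**`cohomologyAnnihilator_eq_four_of_addGenerator`** (`ca(T) = ca⁴(T)`), its levelled form, and the ROUTE-VOCABULARY
form `ca_subset_caAt_four_of_addGenerator` (the `m`-th conjunct `ca T ⊆ caAt 4 T` of `SaturationFourSurfaceResidual₄`
at a subalgebra stage, inline sets verbatim).  Nothing is asserted about which stages admit such a `G`.

References (mechanism / motivation only): S. B. Iyengar, R. Takahashi, IMRN 2016, Def. 4.1, §2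
[`IyengarTakahashi2014`]; J. Wunram, *Reflexive modules on quotient surface singularities*, Math. Ann. 279 (1988);
O. Iyama, M. Wemyss, Math. Z. 265 (2010).
-/

noncomputable section

-- single-problem summit: the doubled namespace component `ResolutionOfSingularities` is forced
set_option linter.dupNamespace false

namespace Summit.ResolutionOfSingularities.ResolutionOfSingularities.Theorems.HomologicalConductor.PersistenceSurfaceSaturationReflexiveGenerator

open CategoryTheory CategoryTheory.Limits CategoryTheory.Abelian Literature.RingTheory.CohomologyAnnihilator
open Summit.ResolutionOfSingularities.ResolutionOfSingularities.Theorems.HomologicalConductor.PersistenceSurfaceSaturationReflexiveSyzygy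
  (cohomologyAnnihilator_eq_four_of_reflexiveSyzygyClass cohomologyAnnihilatorOfDegree_eq_four_of_reflexiveSyzygyClass)
open Summit.ResolutionOfSingularities.ResolutionOfSingularities.Theorems.HomologicalConductor.RecurrenceExclusion
  (finite_of_retract)
open Summit.ResolutionOfSingularities.ResolutionOfSingularities.Theorems.HomologicalConductor.PeriodicSaturationStage
  (ca_subset_caAt_of_le)

universe u

variable {T : Type u} [CommRing T]

/-! ## Finite powers of retractions -/

/-- A retraction `i ≫ r = 𝟙 X` induces a retraction of finite powers. [folklore] -/
theorem compLeft_comp_compLeft_eq_id {X Z : ModuleCat.{u} T} {i : X ⟶ Z} {r : Z ⟶ X} (hir : i ≫ r = 𝟙 X)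
    (m : ℕ) :
    ModuleCat.ofHom (i.hom.compLeft (Fin m)) ≫ ModuleCat.ofHom (r.hom.compLeft (Fin m)) =
      𝟙 (ModuleCat.of T (Fin m → X)) := by
  apply ModuleCat.hom_ext
  refine LinearMap.ext fun x => funext fun j => ?_
  simp only [ModuleCat.hom_comp, ModuleCat.hom_ofHom, LinearMap.coe_comp, Function.comp_apply,
    LinearMap.compLeft_apply, ModuleCat.hom_id, LinearMap.id_coe, id_eq]
  exact retract_apply hir (x j)

/-! ## `add G` is recurrent as soon as `G ∈ add Ω(add G)` -/

/-- Members of `add G` are finitely generated when `G` is. [folklore] -/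
theorem finite_of_isRetractOfPower {G X : ModuleCat.{u} T} [Module.Finite T G] (h : IsRetractOfPower G X) :
    Module.Finite T X := by
  obtain ⟨m, i, p, hip⟩ := h
  exact finite_of_retract i p hip inferInstance

/-- **`add G` is a recurrent class under `(hrec)`**: if `G` is a retract of a first syzygy module `N` of some
`Y ∈ add G`, then every `X ∈ add G` is a retract of a first syzygy module of a member of `add G` (namely
`X ∣ Gᵐ ∣ Nᵐ = Ω(Yᵐ)`). [folklore] -/
theorem isRetractOfPower_recurrent {G : ModuleCat.{u} T}
    (hrec : ∃ (Y N : ModuleCat.{u} T) (i : G ⟶ N) (r : N ⟶ G),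
      IsRetractOfPower G Y ∧ IsSyzygy 1 Y N ∧ i ≫ r = 𝟙 G)
    (X : ModuleCat.{u} T) (hX : IsRetractOfPower G X) :
    ∃ (Y' N' : ModuleCat.{u} T) (i' : X ⟶ N') (r' : N' ⟶ X),
      IsRetractOfPower G Y' ∧ IsSyzygy 1 Y' N' ∧ i' ≫ r' = 𝟙 X := by
  obtain ⟨Y, N, i, r, hY, hN, hir⟩ := hrec
  obtain ⟨m, i₀, p₀, h₀⟩ := hX
  refine ⟨ModuleCat.of T (Fin m → Y), ModuleCat.of T (Fin m → N),
    i₀ ≫ ModuleCat.ofHom (i.hom.compLeft (Fin m)), ModuleCat.ofHom (r.hom.compLeft (Fin m)) ≫ p₀,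
    hY.pi m, hN.pi m, ?_⟩
  rw [Category.assoc, ← Category.assoc (ModuleCat.ofHom _), compLeft_comp_compLeft_eq_id hir m,
    Category.id_comp, h₀]

/-! ## The doors -/

/-- **`Sat₄` from one finitely generated module `G`** (noetherian domain `T`): if every first syzygy module of
every finitely generated reflexive module lies in `add G` (`hΩ`) and `G` is a retract of a first syzygy module of a
member of `add G` (`hrec`), then `ca(T) = ca⁴(T)` — the special-class door with `𝒮 = add G`. [folklore] -/
theorem cohomologyAnnihilator_eq_four_of_addGenerator [IsDomain T] [IsNoetherianRing T] (G : ModuleCat.{u} T)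
    [Module.Finite T G]
    (hrec : ∃ (Y N : ModuleCat.{u} T) (i : G ⟶ N) (r : N ⟶ G),
      IsRetractOfPower G Y ∧ IsSyzygy 1 Y N ∧ i ≫ r = 𝟙 G)
    (hΩ : ∀ (X K : ModuleCat.{u} T), Module.Finite T X → Module.IsReflexive T X → IsSyzygy 1 X K →
      IsRetractOfPower G K) :
    cohomologyAnnihilator T = cohomologyAnnihilatorOfDegree T 4 :=
  cohomologyAnnihilator_eq_four_of_reflexiveSyzygyClass (IsRetractOfPower G)
    (fun _ hS => finite_of_isRetractOfPower hS) (isRetractOfPower_recurrent hrec)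
    (fun X K hX hXr hK => ⟨K, 𝟙 K, 𝟙 K, hΩ X K hX hXr hK, Category.comp_id _⟩)

/-- The same, levelled: `caᵐ(T) = ca⁴(T)` for every `m ≥ 4`. [folklore] -/
theorem cohomologyAnnihilatorOfDegree_eq_four_of_addGenerator [IsDomain T] [IsNoetherianRing T]
    (G : ModuleCat.{u} T) [Module.Finite T G]
    (hrec : ∃ (Y N : ModuleCat.{u} T) (i : G ⟶ N) (r : N ⟶ G),
      IsRetractOfPower G Y ∧ IsSyzygy 1 Y N ∧ i ≫ r = 𝟙 G)
    (hΩ : ∀ (X K : ModuleCat.{u} T), Module.Finite T X → Module.IsReflexive T X → IsSyzygy 1 X K →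
      IsRetractOfPower G K)
    {m : ℕ} (hm : 4 ≤ m) :
    cohomologyAnnihilatorOfDegree T m = cohomologyAnnihilatorOfDegree T 4 :=
  cohomologyAnnihilatorOfDegree_eq_four_of_reflexiveSyzygyClass (IsRetractOfPower G)
    (fun _ hS => finite_of_isRetractOfPower hS) (isRetractOfPower_recurrent hrec)
    (fun X K hX hXr hK => ⟨K, 𝟙 K, 𝟙 K, hΩ X K hX hXr hK, Category.comp_id _⟩) hm

/-- **`(hrec)` in its commonest shape**: `G` a retract of a first syzygy module of a finite power `Gᵐ`.
[folklore] -/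
theorem cohomologyAnnihilator_eq_four_of_addGenerator_pow [IsDomain T] [IsNoetherianRing T]
    (G : ModuleCat.{u} T) [Module.Finite T G]
    (hrec : ∃ (m : ℕ) (N : ModuleCat.{u} T) (i : G ⟶ N) (r : N ⟶ G),
      IsSyzygy 1 (ModuleCat.of T (Fin m → G)) N ∧ i ≫ r = 𝟙 G)
    (hΩ : ∀ (X K : ModuleCat.{u} T), Module.Finite T X → Module.IsReflexive T X → IsSyzygy 1 X K →
      IsRetractOfPower G K) :
    cohomologyAnnihilator T = cohomologyAnnihilatorOfDegree T 4 := by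
  obtain ⟨m, N, i, r, hN, hir⟩ := hrec
  exact cohomologyAnnihilator_eq_four_of_addGenerator G
    ⟨ModuleCat.of T (Fin m → G), N, i, r, (isRetractOfPower_self G).pi m, hN, hir⟩ hΩ

/-! ## Route vocabulary -/

section Route

variable {k K : Type u} [Field k] [Field K] [Algebra k K]

/-- **The finite-type door in ROUTE VOCABULARY**: for a subalgebra stage `T ⊆ K` with `↥T` noetherian and one
finitely generated `↥T`-module `G` satisfying `(hrec)` and `(hΩ)`, the `m`-th conjunct `ca T ⊆ caAt 4 T` of
`SaturationFourSurfaceResidual₄` holds at that stage (inline sets verbatim). [OURS] -/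
theorem ca_subset_caAt_four_of_addGenerator (T : Subalgebra k K) [IsNoetherianRing ↥T] (G : ModuleCat.{u} ↥T)
    [Module.Finite ↥T G]
    (hrec : ∃ (Y N : ModuleCat.{u} ↥T) (i : G ⟶ N) (r : N ⟶ G),
      IsRetractOfPower G Y ∧ IsSyzygy 1 Y N ∧ i ≫ r = 𝟙 G)
    (hΩ : ∀ (X L : ModuleCat.{u} ↥T), Module.Finite ↥T X → Module.IsReflexive ↥T X → IsSyzygy 1 X L →
      IsRetractOfPower G L) :
    {x : K | ∃ hx : x ∈ T, ∃ m : ℕ, ∀ i : ℕ, m ≤ i → ∀ (M N : ModuleCat.{u} ↥T),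
        Module.Finite ↥T M → Module.Finite ↥T N →
          ∀ e : CategoryTheory.Abelian.Ext.{u} M N i, (⟨x, hx⟩ : ↥T) • e = 0} ⊆
      {x : K | ∃ hx : x ∈ T, ∀ i : ℕ, 4 ≤ i → ∀ (M N : ModuleCat.{u} ↥T),
        Module.Finite ↥T M → Module.Finite ↥T N →
          ∀ e : CategoryTheory.Abelian.Ext.{u} M N i, (⟨x, hx⟩ : ↥T) • e = 0} :=
  ca_subset_caAt_of_le T (cohomologyAnnihilator_eq_four_of_addGenerator G hrec hΩ).le

end Route

end Summit.ResolutionOfSingularities.ResolutionOfSingularities.Theorems.HomologicalConductor.PersistenceSurfaceSaturationReflexiveGenerator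

end
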